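import Summits.AtomisticToContinuum.BoseEinsteinCondensation.Theorems.PeriodicIRBound.Negative.FreeGas
import Summits.AtomisticToContinuum.BoseEinsteinCondensation.Theorems.PeriodicIRBound.Negative.HardCoreScope
import Summits.AtomisticToContinuum.BoseEinsteinCondensation.Theorems.BECGroundStateSOSPeriodicEnergyFinite
import Summits.AtomisticToContinuum.BoseEinsteinCondensation.Theses.BECTwoSectorGD
import Summits.AtomisticToContinuum.BoseEinsteinCondensation.Theses.BECSectorPoincareTwoScale

/-!
# Crux-ideate round 2, ideator 4 — first lemmas for crux `PeriodicIRBound` (stmt-AtomisticToContinuum-3972)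

Two idea cards (folder `idea-*.md`, filed `ledger idea add --crux`):

* §A  card `soft-mode-energy-release` — Hellmann–Feynman in the SINGLE-MODE DISPERSION, used one-sidedly:
  for every periodic trial state `Φ`, `θ ε_k (n_k(Φ) + n_{-k}(Φ)) = ⟨Φ,HΦ⟩ − ⟨Φ,H_θ Φ⟩` where
  `H_θ = H − θ ε_k (a_k†a_k + a_{−k}†a_{−k})` has dispersion `ε_p(1 − θ·1_{p=±k})`; hence the crux follows
  from a RELATIVE GROUND-STATE ENERGY bound `E₀(H) ≤ inf H_θ + θ ε_k · C√ρ L/‖k‖` (= the operator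
  inequality `SoftModeOperatorIRFor`). The transfer `irBoundFor_of_softMode` is two lines of arithmetic
  (the near-minimiser slack `δ_N := 4π²θC√ρ/L_N` is exactly the one-phonon scale of Disproof §16).
* §B  card `two-sector-gd-transfer` — pool with `BECTwoSectorGD.GaussianDomination` (stmt-12620) +
  `BECSectorPoincareTwoScale.EnergyConvexityWindow` (stmt-9094): Kennedy–Lieb–Shastry's T = 0 Cauchy–Schwarz
  with the two one-particle-transfer susceptibilities; the scalar endgame `kls_quadratic` is proved here.
-/

noncomputable section

open MeasureTheory Filter
open scoped ENNReal NNReal BigOperators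

namespace Summit.AtomisticToContinuum.BoseEinsteinCondensation.Cruxes.PeriodicIRBound.IdeatorR2K4

open Literature.MathematicalPhysics.QuantumManyBody.BoseGas
open Summit.AtomisticToContinuum.BoseEinsteinCondensation.Theses.BECGroundStateSOS
open Summit.AtomisticToContinuum.BoseEinsteinCondensation.Theorems.PeriodicIRBound.Negative
open Summit.AtomisticToContinuum.BoseEinsteinCondensation.Theorems.GaussianDominationCan.Negative
  (nsq nsq_nonneg one_le_norm_intVec)

/-! ## §A  Soft-mode energy release (card `soft-mode-energy-release`) -/

/-- Bare kinetic energy `ε_k = |2πk/L|₂² = 4π² (∑ k_j²)/L²` of the plane wave `k ∈ ℤ³` on the torus of side `L`. -/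
def modeDispersion (L : ℝ) (k : Fin 3 → ℤ) : ℝ := 4 * Real.pi ^ 2 * nsq k / L ^ 2

/-- **Soft-mode operator infrared bound** for one potential `v` (transfer target `C⁺` of the card):
for every window `κ` there are `θ ∈ (0,1]`-type softening `θ > 0`, `ρ₀ > 0`, `C > 0` with, for `ρ < ρ₀`,
eventually in `N`, for every window mode `k` and EVERY periodic trial state `Φ` (no near-minimiser, no
ground state): `E₀^per(N,L_N) + θ ε_k (n_k(Φ) + n_{−k}(Φ)) ≤ ⟨Φ,HΦ⟩ + θ ε_k · C√ρ L_N/‖k‖_∞`, i.e. the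
Hamiltonian with the dispersion of the pair `±k` softened by the factor `(1−θ)` has ground energy
`≥ E₀^per − θ ε_k C√ρL_N/‖k‖` — softening one mode pair releases at most `C` phonons' worth of energy.
Free gas: true with every `C > 0` and `θ ≤ 1` (`H − E₀ = ∑ ε_p n_p`); Bogoliubov: release
`2[(E_k−ε_k) − (E_k(θ)−(1−θ)ε_k)] ≤ 2θ(∂E_k/∂ε_k − 1)… ≍ θ√(ρa)|k|`, i.e. `C ≍ √a`, `‖v‖₁`-free. -/
def SoftModeOperatorIRFor (v : ℝ → ℝ≥0∞) : Prop :=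
  ∀ κ : ℝ, 0 < κ → ∃ θ : ℝ, 0 < θ ∧ ∃ ρ₀ : ℝ, 0 < ρ₀ ∧ ∃ C : ℝ, 0 < C ∧ ∀ ρ : ℝ, 0 < ρ → ρ < ρ₀ →
    ∀ᶠ N : ℕ in atTop, ∀ k : Fin 3 → ℤ, InWindow κ ρ N k →
      ∀ Φ : PeriodicTrialState N (sideLength ρ N),
        periodicGroundStateEnergy v N (sideLength ρ N) +
            ENNReal.ofReal (θ * modeDispersion (sideLength ρ N) k) *
              (cellOccupation N (sideLength ρ N) (planeWaveMode (sideLength ρ N) k) Φ.ψ +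
                cellOccupation N (sideLength ρ N) (planeWaveMode (sideLength ρ N) (-k)) Φ.ψ) ≤
          periodicEnergy v Φ +
            ENNReal.ofReal (θ * modeDispersion (sideLength ρ N) k *
              (C * Real.sqrt ρ * sideLength ρ N / ‖(fun j => (k j : ℝ))‖))

/-- The all-potentials form of the transfer target. -/
def SoftModeOperatorIR : Prop :=
  ∀ v : ℝ → ℝ≥0∞, IsRepulsiveFiniteRange v → SoftModeOperatorIRFor v

/-- Real-arithmetic core of the transfer: `(4π²θC√ρ/L)/(θ·4π² q/L²) = C√ρL/q`. -/
theorem slack_div_dispersion {θ C ρ L q : ℝ} (hθ : 0 < θ) (hL : 0 < L) (hq : 0 < q) :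
    (4 * Real.pi ^ 2 * θ * C * Real.sqrt ρ / L) / (θ * (4 * Real.pi ^ 2 * q / L ^ 2)) =
      C * Real.sqrt ρ * L / q := by
  have hπ : (0 : ℝ) < Real.pi := Real.pi_pos
  field_simp

/-- **Transfer (first lemma of card `soft-mode-energy-release`)**: the soft-mode operator bound for `v`
implies the crux for `v`, given finiteness of `E₀^per` along `L_N` (the route's PROVED support
`PeriodicEnergyFinite`). Proof: for a `δ`-near-minimiser `Ψ`, `θε_k n_k ≤ θε_k(n_k+n_{−k}) ≤ δ + θε_k C√ρL/‖k‖`;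
with `δ := 4π²θC√ρ/L_N` (one phonon, Disproof §16) and `ε_k = 4π² nsq k/L²`, `δ/(θε_k) = C√ρL/nsq k ≤ C√ρL/‖k‖_∞`,
so `n_k ≤ 2C√ρL/‖k‖_∞`. -/
theorem irBoundFor_of_softMode {v : ℝ → ℝ≥0∞}
    (hfin : ∃ ρ₁ : ℝ, 0 < ρ₁ ∧ ∀ ρ : ℝ, 0 < ρ → ρ < ρ₁ →
      ∀ᶠ N : ℕ in atTop, periodicGroundStateEnergy v N (sideLength ρ N) ≠ ⊤)
    (h : SoftModeOperatorIRFor v) : IRBoundFor v := by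
  intro κ hκ
  obtain ⟨ρ₁, hρ₁, hfin⟩ := hfin
  obtain ⟨θ, hθ, ρ₀, hρ₀, C, hC, h⟩ := h κ hκ
  refine ⟨min ρ₀ ρ₁, lt_min hρ₀ hρ₁, 2 * C, by positivity, fun ρ hρ hρρ₀ => ?_⟩
  have hρ0 : ρ < ρ₀ := lt_of_lt_of_le hρρ₀ (min_le_left _ _)
  have hρ1 : ρ < ρ₁ := lt_of_lt_of_le hρρ₀ (min_le_right _ _)
  filter_upwards [h ρ hρ hρ0, hfin ρ hρ hρ1, eventually_gt_atTop 0] with N hN hE0 hNpos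
  set L := sideLength ρ N with hLdef
  have hL : 0 < L := sideLength_pos_of_pos hρ hNpos
  -- the one-phonon slack
  set δr : ℝ := 4 * Real.pi ^ 2 * θ * C * Real.sqrt ρ / L with hδr
  have hδr_pos : 0 < δr := by
    have hπ : (0 : ℝ) < Real.pi := Real.pi_pos
    have hsq : 0 < Real.sqrt ρ := Real.sqrt_pos.2 hρ
    positivity
  refine ⟨ENNReal.ofReal δr, ENNReal.ofReal_pos.2 hδr_pos, fun Ψ hΨ k hk => ?_⟩
  have hk0 : k ≠ 0 := hk.1
  have hq : 0 < nsq k := lt_of_lt_of_le one_pos (one_le_nsq hk0)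
  have hnorm : 0 < ‖(fun j => (k j : ℝ))‖ := lt_of_lt_of_le one_pos (one_le_norm_intVec hk0)
  have hεpos : 0 < θ * modeDispersion L k := by
    unfold modeDispersion
    have hπ : (0 : ℝ) < Real.pi := Real.pi_pos
    positivity
  -- abbreviations
  set a : ℝ≥0∞ := ENNReal.ofReal (θ * modeDispersion L k) with ha
  set nk := cellOccupation N L (planeWaveMode L k) Ψ.ψ with hnk
  set nmk := cellOccupation N L (planeWaveMode L (-k)) Ψ.ψ with hnmk
  set B : ℝ := C * Real.sqrt ρ * L / ‖(fun j => (k j : ℝ))‖ with hB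
  have hBnn : 0 ≤ B := by
    have : 0 ≤ Real.sqrt ρ := Real.sqrt_nonneg ρ
    positivity
  have ha0 : a ≠ 0 := (ENNReal.ofReal_pos.2 hεpos).ne'
  have hatop : a ≠ ⊤ := ENNReal.ofReal_ne_top
  -- the soft-mode inequality at Ψ, combined with the near-minimiser hypothesis
  have h1 := hN k hk Ψ
  have h2 : periodicGroundStateEnergy v N L + a * (nk + nmk) ≤
      periodicGroundStateEnergy v N L + (ENNReal.ofReal δr + ENNReal.ofReal (θ * modeDispersion L k * B)) := by
    calc periodicGroundStateEnergy v N L + a * (nk + nmk)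
        ≤ periodicEnergy v Ψ + ENNReal.ofReal (θ * modeDispersion L k * B) := h1
      _ ≤ (periodicGroundStateEnergy v N L + ENNReal.ofReal δr) +
            ENNReal.ofReal (θ * modeDispersion L k * B) := by
          gcongr
          exact hΨ
      _ = _ := by rw [add_assoc]
  have h3 : a * (nk + nmk) ≤ ENNReal.ofReal δr + ENNReal.ofReal (θ * modeDispersion L k * B) :=
    (ENNReal.add_le_add_iff_left hE0).1 h2
  have h4 : a * nk ≤ ENNReal.ofReal δr + ENNReal.ofReal (θ * modeDispersion L k * B) :=
    le_trans (mul_le_mul_right (le_self_add) a) h3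
  -- divide by a
  have h5 : nk ≤ (ENNReal.ofReal δr + ENNReal.ofReal (θ * modeDispersion L k * B)) / a := by
    rw [ENNReal.le_div_iff_mul_le (Or.inl ha0) (Or.inl hatop), mul_comm]
    exact h4
  -- evaluate the right-hand side in ℝ
  have hsum : ENNReal.ofReal δr + ENNReal.ofReal (θ * modeDispersion L k * B) =
      ENNReal.ofReal (δr + θ * modeDispersion L k * B) := by
    rw [ENNReal.ofReal_add hδr_pos.le (mul_nonneg hεpos.le hBnn)]
  have hdiv : (ENNReal.ofReal (δr + θ * modeDispersion L k * B)) / a =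
      ENNReal.ofReal ((δr + θ * modeDispersion L k * B) / (θ * modeDispersion L k)) := by
    rw [ha, ENNReal.ofReal_div_of_pos hεpos]
  have hreal : (δr + θ * modeDispersion L k * B) / (θ * modeDispersion L k) =
      C * Real.sqrt ρ * L / nsq k + B := by
    rw [add_div, mul_div_cancel_left₀ B hεpos.ne']
    congr 1
    rw [hδr]
    unfold modeDispersion
    exact slack_div_dispersion hθ hL hq
  have hmono : C * Real.sqrt ρ * L / nsq k ≤ C * Real.sqrt ρ * L / ‖(fun j => (k j : ℝ))‖ := by
    apply div_le_div_of_nonneg_left _ hnorm (norm_intVec_le_nsq k)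
    have : 0 ≤ Real.sqrt ρ := Real.sqrt_nonneg ρ
    positivity
  have hle : C * Real.sqrt ρ * L / nsq k + B ≤ 2 * C * Real.sqrt ρ * L / ‖(fun j => (k j : ℝ))‖ := by
    have h2 : 2 * C * Real.sqrt ρ * L / ‖(fun j => (k j : ℝ))‖ =
        C * Real.sqrt ρ * L / ‖(fun j => (k j : ℝ))‖ + C * Real.sqrt ρ * L / ‖(fun j => (k j : ℝ))‖ := by
      ring
    rw [h2, hB]
    exact add_le_add hmono le_rfl
  -- conclude
  rw [irIneq_iff]
  calc cellOccupation N L (planeWaveMode L k) Ψ.ψ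
      ≤ (ENNReal.ofReal δr + ENNReal.ofReal (θ * modeDispersion L k * B)) / a := h5
    _ = ENNReal.ofReal (C * Real.sqrt ρ * L / nsq k + B) := by rw [hsum, hdiv, hreal]
    _ ≤ ENNReal.ofReal (2 * C * Real.sqrt ρ * L / ‖(fun j => (k j : ℝ))‖) :=
        ENNReal.ofReal_le_ofReal hle

/-- **Composition to the crux by name**: finiteness (proved support item) + soft-mode bound ⇒ `PeriodicIRBound`. -/
theorem periodicIRBound_of_softMode (hfin : PeriodicEnergyFinite) (h : SoftModeOperatorIR) :
    PeriodicIRBound := by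
  rw [periodicIRBound_iff]
  intro v hv
  exact irBoundFor_of_softMode (hfin v hv) (h v hv)

/-- Unconditional form: the finiteness hypothesis IS proved in the tree (`periodicEnergyFinite_proof`). -/
theorem periodicIRBound_of_softMode' (h : SoftModeOperatorIR) : PeriodicIRBound :=
  periodicIRBound_of_softMode Theorems.periodicEnergyFinite_proof h

/-! ## §B  Two-sector Gaussian-domination transfer (card `two-sector-gd-transfer`) -/

/-- **KLS scalar endgame** (first lemma of card `two-sector-gd-transfer`, PROVED): if `y = 2n_k + 1 ≥ 0`
satisfies the Kennedy–Lieb–Shastry Cauchy–Schwarz inequality `y² ≤ b (d + e·y)` with susceptibility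
`b ≥ 0` (Gaussian domination: `b ≤ C L²/‖n‖²`), double commutator `d ≥ 0` (`d ≤ ε_k + 2ρ‖v‖₁`) and
convexity defect `e ≥ 0` (`e ≤ μ⁻ − μ⁺ ≤ ε√(ρa)/L` from stmt-9094), then `y ≤ b·e + √(b·d)`:
the `1/‖k‖` law `√(bd) ≍ √(CL²(ε_k + 2ρ‖v‖₁))/‖n‖` plus the convexity term `b e ≍ Cε√(ρa)L/‖n‖²`. [folklore] -/
theorem kls_quadratic {y b d e : ℝ} (hy : 0 ≤ y) (hb : 0 ≤ b) (hd : 0 ≤ d) (he : 0 ≤ e)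
    (h : y ^ 2 ≤ b * (d + e * y)) : y ≤ b * e + Real.sqrt (b * d) := by
  have hbd : 0 ≤ b * d := mul_nonneg hb hd
  have hs : Real.sqrt (b * d) ^ 2 = b * d := Real.sq_sqrt hbd
  have hs0 : 0 ≤ Real.sqrt (b * d) := Real.sqrt_nonneg _
  by_contra hlt
  push Not at hlt
  -- y > b e + √(bd) ⇒ y² > b e y + b d
  have hbe : 0 ≤ b * e := mul_nonneg hb he
  have h1 : y * y > (b * e + Real.sqrt (b * d)) * y := by
    exact mul_lt_mul_of_pos_right hlt (lt_of_le_of_lt (add_nonneg hbe hs0) hlt)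
  have h2 : (b * e + Real.sqrt (b * d)) * y ≥ b * e * y + b * d := by
    have : Real.sqrt (b * d) * y ≥ Real.sqrt (b * d) * Real.sqrt (b * d) :=
      mul_le_mul_of_nonneg_left (le_of_lt (lt_of_le_of_lt (by linarith [hbe]) hlt)) hs0
    nlinarith [this, hs]
  have h3 : y ^ 2 > b * (d + e * y) := by nlinarith [h1, h2]
  exact absurd h (not_le.2 h3)

/-- The integrable half of the crux (per potential, `∫ v < ∞`). -/
def IntegrableHalf : Prop :=
  ∀ v : ℝ → ℝ≥0∞, IsRepulsiveFiniteRange v → (∫⁻ x : Space, v ‖x‖) ≠ ⊤ → IRBoundFor v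

/-- The non-integrable half (hard cores, `∫ v = ⊤`): the crux verbatim on that class (owned elsewhere:
`BECTwoSectorGD.HardCoreExtension` stmt-12621 / the Dyson-dressed moment bound 6b ~ stmt-11844). -/
def NonIntegrableHalf : Prop :=
  ∀ v : ℝ → ℝ≥0∞, IsRepulsiveFiniteRange v → (∫⁻ x : Space, v ‖x‖) = ⊤ → IRBoundFor v

/-- **Line statement of card `two-sector-gd-transfer`** (the XL Kennedy–Lieb–Shastry transfer, NOT proved
here): two-sector Gaussian domination (stmt-12620, window `|2πn/L| ≤ K`, susceptibilities `b_± ≤ C/k²`)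
plus midpoint near-convexity (stmt-9094, `μ⁻ − μ⁺ ≤ ε√(ρa)/L`) give the integrable half with the crux's
PURE `1/‖k‖` shape: Kato 2×2 ⇒ `b_± ≤ CL²/‖n‖²`; spectral Cauchy–Schwarz at the exact torus ground state
`2n_k+1 ≤ √((b₋+b₊)(d₋+d₊))`, `d₋+d₊ ≤ ε_k + 2ρ‖v‖₁ + (μ⁻−μ⁺)n_k`; `kls_quadratic`; window inclusion
`κ√ρ ≤ K` for `ρ < (K/κ)²`; transfer to `δ`-near-minimisers via `irBoundWith_of_ground` (Disproof §11). -/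
theorem integrableHalf_of_twoSectorGD :
    Theses.BECTwoSectorGD.GaussianDomination →
      Theses.BECSectorPoincareTwoScale.EnergyConvexityWindow → IntegrableHalf := by
  sorry

/-- Composition to the crux by name from the two halves (Disproof §19 `periodicIRBound_iff_split`). -/
theorem periodicIRBound_of_twoSectorGD
    (hGD : Theses.BECTwoSectorGD.GaussianDomination)
    (hconv : Theses.BECSectorPoincareTwoScale.EnergyConvexityWindow)
    (hhard : NonIntegrableHalf) : PeriodicIRBound :=
  periodicIRBound_iff_split.2 ⟨integrableHalf_of_twoSectorGD hGD hconv, hhard⟩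

end Summit.AtomisticToContinuum.BoseEinsteinCondensation.Cruxes.PeriodicIRBound.IdeatorR2K4
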